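import Mathlib

/-!
# Venture AbcShadow — SH-27: power traces of a `2 × 2` matrix (the linear algebra inside LEMMA-SH27-1), PROVED

HONEST FRAMING. Small algebra file of the work-bound cell `abc-shadow` (typer seat `abc-shadow-typ-4`, row SH-27); no claim on
abc, on any summit, or on IUT; no Diophantine statement.

LEMMA-SH27-1 of the cell's spec (ENGINE-SPEC-SH27 sha16 9d55c9c4a06f0a3d §2.3 U1; unprinted, "routine"; printed anchor
[Che10, p.366]: "`ρ|G_{K_β}` is isomorphic to `φ_{E,p}`"; printed biquadratic analogue [BC12, Lemma 24]) reads: if `F = ρ̂(Frob_q)`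
has trace `τ` and determinant `d`, then `tr F^f` for the residue degree `f ∈ {1, 2, 4}` of `q` in `K_β` is `τ`, `τ² − 2d`,
`τ⁴ − 4dτ² + 2d²` respectively, and equals the trace of Frobenius `a_𝔮(E_β)` at a prime `𝔮 ∣ q` of `K_β`. The SECOND half
(the identification `ρ̂|G_{K_β} ≅ φ̂_{E_β,p}` and good reduction) is Galois-representation theory and stays a NAMED HYPOTHESIS
(`SH27/Che10Package.lean`); the FIRST half is Cayley–Hamilton for `2 × 2` matrices and is PROVED here for every commutative
ring: `powerTrace τ d n` is the Newton recursion `p₀ = 2`, `p₁ = τ`, `p_{n+2} = τ·p_{n+1} − d·p_n`, and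
`Matrix.trace (A ^ n) = powerTrace (trace A) (det A) n` (`trace_pow_eq_powerTrace`), with the closed forms at `n = 2, 4`
(`powerTrace_two`, `powerTrace_four`). References: [Che10] I. Chen, Acta Arith. 143 (2010); [BC12] M. A. Bennett, I. Chen,
Algebra Number Theory 6 (2012), Lemma 24. ADJACENT, NOT abc.
-/

namespace Summit.Ventures.AbcShadow
namespace SH27

/-- Newton's recursion for the power sums of the two eigenvalues of a `2 × 2` matrix with trace `τ` and determinant `d`:
`p₀ = 2`, `p₁ = τ`, `p_{n+2} = τ p_{n+1} − d p_n`; so `p_n = tr F^n` (`trace_pow_eq_powerTrace`). [folklore] -/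
def powerTrace {R : Type*} [CommRing R] (τ d : R) : ℕ → R
  | 0 => 2
  | 1 => τ
  | n + 2 => τ * powerTrace τ d (n + 1) - d * powerTrace τ d n

/-- `p₂ = τ² − 2d`. [folklore] -/
theorem powerTrace_two {R : Type*} [CommRing R] (τ d : R) : powerTrace τ d 2 = τ ^ 2 - 2 * d := by
  simp only [powerTrace]; ring

/-- `p₄ = τ⁴ − 4dτ² + 2d²` (the `f = 4` case of LEMMA-SH27-1). [folklore] -/
theorem powerTrace_four {R : Type*} [CommRing R] (τ d : R) :
    powerTrace τ d 4 = τ ^ 4 - 4 * d * τ ^ 2 + 2 * d ^ 2 := by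
  simp only [powerTrace]; ring

/-- Cayley–Hamilton for `2 × 2` matrices: `A² = (tr A)·A − (det A)·1`. [folklore] -/
theorem sq_eq_trace_smul_sub_det {R : Type*} [CommRing R] (A : Matrix (Fin 2) (Fin 2) R) :
    A ^ 2 = A.trace • A - A.det • (1 : Matrix (Fin 2) (Fin 2) R) := by
  ext i j
  rw [sq, Matrix.trace_fin_two, Matrix.det_fin_two]
  fin_cases i <;> fin_cases j <;> simp [Matrix.mul_apply, Fin.sum_univ_two] <;> ring

/-- **`tr Aⁿ = p_n(tr A, det A)`** for every `2 × 2` matrix over a commutative ring — the linear-algebra half of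
LEMMA-SH27-1 (`tr ρ̂(Frob_q)^f` in terms of `a_q(f)` and `ε⁻¹(q)q`). [folklore] -/
theorem trace_pow_eq_powerTrace {R : Type*} [CommRing R] (A : Matrix (Fin 2) (Fin 2) R) :
    ∀ n : ℕ, (A ^ n).trace = powerTrace A.trace A.det n
  | 0 => by simp [powerTrace]
  | 1 => by simp [powerTrace]
  | n + 2 => by
      have h2 := sq_eq_trace_smul_sub_det A
      have ih1 := trace_pow_eq_powerTrace A (n + 1)
      have ih0 := trace_pow_eq_powerTrace A n
      rw [powerTrace, ← ih1, ← ih0, pow_add, h2, Matrix.mul_sub, Matrix.mul_smul, Matrix.mul_smul, Matrix.mul_one,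
        ← pow_succ, Matrix.trace_sub, Matrix.trace_smul, Matrix.trace_smul, smul_eq_mul, smul_eq_mul]

end SH27
end Summit.Ventures.AbcShadow
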